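import Literature.MathematicalPhysics.QuantumFieldTheory.Balaban1983to89.Node00.CriticalOnFibreTopHalving
import Summits.QuantumFields.YangMills.Theorems.BalabanUVNodesK0AllTorusOfStepTokensRCube
import Summits.QuantumFields.YangMills.Theorems.BalabanUVNodesK0VariationalThm1CoP7EmptySupport

/-!
# K0⁷ — THE ONE-PASS SOCKET FOR STUB 1: K0⁷'s body from [15] Sect. F's one-step improvement `HalvingStepTop` (dag-n07-e module 30) in place of
# Proposition 8's top step, and from the FLOOR-FREE form of stub 1 (the conjunct `2L² ≤ B₃` is derived)

Cell `pub-ymgap`, seat `pub-ymgap-dag-n21-c` generation 16 (R134 (a) N21 NE7c s1 + K0⁷ road lineage; human ruling D-0149 «work-bound push», director-ym LINE №197,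
plan g77 `W-SEAT-START-LIST` v1 row k0-s1 item w3).  `--kind proof --supports stmt-QuantumFields-20541 --as helper`.  NEW leaf; nothing modified; no new named fact.

WHY.  K0⁷ `Record13SepCoPHInhabited` (skeleton V18, sha16 3bcb71246bb7298d) is composed on every family `F : T4Family` from three print stubs by this lineage's Cʷ″
`K0AllTorusOfStepTokensRCube.record13SepCoPHBody_of_stubs123A`.  Its stub 1 reads `∃ B₃ a₀ a₁, 2L² ≤ B₃ ∧ 0 < a₀ ∧ 0 < a₁ ∧ Prop8RegSepTopStep F 2 suppDomOfRecord B₃ a₀ a₁`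
([15] Prop. 8's top step at NODE 00's objects).  Two kernel facts make a SMALLER literal target sufficient for the incoming stub-1 seats (`pub-ymgap-k0-s1-w1..3`):
(i) dag-n07-e's module 30 (`Node00.CriticalOnFibreTopHalving`, p550807): for `0 < B₃`, `Prop8RegSepTopStep` ⟸ `HalvingStepTop` — print's *«we continue this way until we reach
the bound B₃ε₁»* is done in the kernel, so the debt is ONE PASS of Sect. F ((144)–(168)); (ii) this lineage's floor mode
`K0VariationalThm1Top7Engine.two_sq_L_le_of_prop8RegSepTopStep`: at `N = 2` the top step with `0 < a₀`, `0 < a₁` FORCES `2L² ≤ B₃`, so the floor conjunct of stub 1 is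
not extra work.  This file wires both into the composition: a seat that lands `∀ F, ∃ B₃ a₀ a₁, 0 < B₃ ∧ 0 < a₀ ∧ 0 < a₁ ∧ HalvingStepTop F 2 suppDomOfRecord B₃ a₀ a₁`
closes stub 1 AS REGISTERED through `prop8StepCoP_of_halvingStepTop` (one line), and K0⁷'s body follows from it with stubs 2, 3ᴬ VERBATIM
(`record13SepCoPHBody_of_halvingStepTop23A`).  V18 is NOT re-registered (plan's call); this is a by-name door.

CONTENTS.  §1 `prop8StepCoP_of_pos` (stub 1's body from the floor-free form), `two_sq_L_le_of_halvingStepTop`, `prop8StepCoP_of_halvingStepTop`.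
§2 `record13SepCoPHBody_of_stubs1pos23A`, ★ `record13SepCoPHBody_of_halvingStepTop23A`.

HONEST FRAMING: count-neutral kernel bookkeeping BY NAME; CONDITIONAL compositions whose antecedents are the OPEN stubs themselves (A6: not inhabited here — stub 1 = N07's
[15] Sect. F at objects, stub 2 = N05's [6] Prop. 6 at the member, stub 3ᴬ = NODE O, print-stated [I] §1 p.264 with unpublished proof [II] p.355); nothing of Bałaban is
asserted; K0⁷ OPEN; counts unmoved (typed 28∕28 · discharged 5∕27); one finite 𝕋⁴ programme at fixed ε — NOT continuum ∕ ℝ⁴ ∕ OS ∕ mass gap ∕ Clay.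
[15] = Bałaban, CMP 102 (1985) 277 [Balaban1985Variational]; [6] = CMP 99 (1985) 75 [Balaban1985RegularSpaces]; [III] = CMP 119 (1988) 243 [Balaban1988Convergent];
[I] = CMP 109 (1987) 249 [Balaban1987RG1]; [II] = CMP 122 (1989) 355 [Balaban1989LargeFieldII].
-/

noncomputable section

open scoped Matrix.Norms.L2Operator

namespace Summit.QuantumFields.YangMills.Theorems.K0HalvingStepSocket

open Literature.MathematicalPhysics.QuantumFieldTheory.Balaban1983to89
open Literature.MathematicalPhysics.QuantumFieldTheory.Balaban1983to89.Node00
open Literature.MathematicalPhysics.QuantumFieldTheory.Balaban1983to89.T4Continuum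
open Literature.MathematicalPhysics.QuantumFieldTheory.Balaban1983to89.FlowStep
open Summit.QuantumFields.YangMills.Theorems.K0VariationalThm1Top7Engine (two_sq_L_le_of_prop8RegSepTopStep)
open Summit.QuantumFields.YangMills.Theorems.K0AllTorusOfStepTokensRCube (record13SepCoPHBody_of_stubs123A)

/-! ## §1  Stub 1's registered body from the floor-free form and from the one-pass sentence -/

section StubOne

variable (F : T4Family)

/-- **STUB 1's REGISTERED BODY FROM THE FLOOR-FREE FORM**: at `N = 2`, [15] Prop. 8's top step at the record's support selector with positive ceilings `a₀`, `a₁` already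
carries print's floor `2L² ≤ B₃` (floor mode `two_sq_L_le_of_prop8RegSepTopStep`), so it inhabits V18's `Prop8StepCoPAt F` verbatim.
[cite: Balaban1985Variational, Prop. 8 p.304, Thm 1 (7)–(8) pp.278–279; Balaban1985RegularSpaces, (1.3)–(1.9) p.77 (bookkeeping)] -/
theorem prop8StepCoP_of_pos {B₃ a₀ a₁ : ℝ} (ha₀ : 0 < a₀) (ha₁ : 0 < a₁)
    (h8 : Prop8RegSepTopStep F 2 (fun ν K Ω => suppDomOfRecord F ν K Ω) B₃ a₀ a₁) :
    ∃ B₃ a₀ a₁ : ℝ, 2 * (F.L : ℝ) ^ 2 ≤ B₃ ∧ 0 < a₀ ∧ 0 < a₁ ∧ Prop8RegSepTopStep F 2 (fun ν K Ω => suppDomOfRecord F ν K Ω) B₃ a₀ a₁ :=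
  ⟨B₃, a₀, a₁, two_sq_L_le_of_prop8RegSepTopStep (F := F) (fun ν K Ω => suppDomOfRecord F ν K Ω) le_rfl ha₀ ha₁ h8, ha₀, ha₁, h8⟩

/-- **THE FLOOR TRANSFERS TO THE ONE-PASS SENTENCE**: for `0 < B₃`, `0 < a₀`, `0 < a₁`, Sect. F's one-step improvement at the objects of record on ANY top domain forces
`2L² ≤ B₃` (module 30's `prop8RegSepTopStep_of_halvingStepTop`, then the floor mode at `N = 2`). [cite: Balaban1985Variational, Sect. F pp.300–304, Prop. 8 p.304 (bookkeeping)] -/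
theorem two_sq_L_le_of_halvingStepTop (Sup : (ν : Stage7Numerics) → (K : ℕ) → (ℕ → Set (Site (F.P K) 0)) → Set (Site (F.P K) 0)) {B₃ a₀ a₁ : ℝ}
    (hB₃ : 0 < B₃) (ha₀ : 0 < a₀) (ha₁ : 0 < a₁) (h : HalvingStepTop F 2 Sup B₃ a₀ a₁) : 2 * (F.L : ℝ) ^ 2 ≤ B₃ :=
  two_sq_L_le_of_prop8RegSepTopStep (F := F) Sup le_rfl ha₀ ha₁ (prop8RegSepTopStep_of_halvingStepTop hB₃ h)

/-- **STUB 1's REGISTERED BODY FROM THE ONE-PASS SENTENCE**: `0 < B₃`, `0 < a₀`, `0 < a₁` and `HalvingStepTop F 2 suppDomOfRecord B₃ a₀ a₁` ([15] Sect. F (144)–(168) at NODE 00's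
objects, ONE pass) inhabit V18's `Prop8StepCoPAt F` — the iteration to `B₃ε₁` (module 30) and the floor `2L² ≤ B₃` are supplied by the kernel.  A `k0-s1` seat landing the one-pass
form for every `F` closes `stub_prop8StepCoP13` through this theorem in one line. [cite: Balaban1985Variational, Sect. F pp.300–304, Prop. 8 p.304; Balaban1988Convergent, (2.6)–(2.8) pp.255–256] -/
theorem prop8StepCoP_of_halvingStepTop {B₃ a₀ a₁ : ℝ} (hB₃ : 0 < B₃) (ha₀ : 0 < a₀) (ha₁ : 0 < a₁)
    (h : HalvingStepTop F 2 (fun ν K Ω => suppDomOfRecord F ν K Ω) B₃ a₀ a₁) :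
    ∃ B₃ a₀ a₁ : ℝ, 2 * (F.L : ℝ) ^ 2 ≤ B₃ ∧ 0 < a₀ ∧ 0 < a₁ ∧ Prop8RegSepTopStep F 2 (fun ν K Ω => suppDomOfRecord F ν K Ω) B₃ a₀ a₁ :=
  prop8StepCoP_of_pos F ha₀ ha₁ (prop8RegSepTopStep_of_halvingStepTop hB₃ h)

end StubOne

/-! ## §2  K0⁷'s body at every family from the floor-free ∕ one-pass forms of stub 1, stubs 2 and 3ᴬ verbatim -/

section Composition

/-- **K0⁷'s BODY AT EVERY FAMILY FROM THE FLOOR-FREE STUB 1, STUB 2, STUB 3ᴬ**: Cʷ″ `record13SepCoPHBody_of_stubs123A` with its first binder replaced by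
`∀ F, ∃ B₃ a₀ a₁, 0 < a₀ ∧ 0 < a₁ ∧ Prop8RegSepTopStep …` (no floor conjunct; §1 supplies it); `h2`, `h3A` are V18's stubs 2, 3ᴬ VERBATIM.  CONDITIONAL; K0⁷ NOT closed here.
[cite: Balaban1985Variational, Thm 1 (8)–(9) p.279, Prop. 8 p.304; Balaban1985RegularSpaces, Prop. 6 p.99; Balaban1988Convergent, Thm 1 p.262, (2.6)–(2.8) pp.255–256; Balaban1987RG1, Thm 1 p.259, §1 p.264] -/
theorem record13SepCoPHBody_of_stubs1pos23A
    (h1 : ∀ F : T4Family, ∃ B₃ a₀ a₁ : ℝ, 0 < a₀ ∧ 0 < a₁ ∧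
      Prop8RegSepTopStep F 2 (fun ν K Ω => suppDomOfRecord F ν K Ω) B₃ a₀ a₁)
    (h2 : ∀ F : T4Family, ∃ B₁ c₁ : ℝ, 0 ≤ B₁ ∧ 0 < c₁ ∧
      (letI : CStarAlgebra (MatA 2) := {}; B8.Prop6Printed 4 (F.L : ℝ) B₁ c₁ (fun i : B8LeafModelZd.ZdIdx 4 F.L => zdCub (MatA 2) F.L i)))
    (h3A : ∀ (F : T4Family) (B₃ B₃' a₀ a₁ : ℝ), 2 * (F.L : ℝ) ^ 2 ≤ B₃ → 0 < B₃' → 0 < a₀ → 0 < a₁ →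
      VariationalThm1RegSepCoP7M F 2 B₃ a₀ a₁ →
      Gauge9RegSepTopStepR F 2 (fun ν K Ω => suppDomOfRecord F ν K Ω) (F.L ^ 3) ((11 * 4 + 3 * F.L) * F.L) B₃ B₃' a₀ a₁ →
      ∃ γ₀ ε₀ ε₂₉ β' : ℝ, 0 < γ₀ ∧ 0 < ε₀ ∧ 0 < ε₂₉ ∧
        BetaLowerH (-β') γ₀ (betaOfRecord₁₃ F 2 (theta13OfThm1CCM F 2 3 ε₀ ε₂₉ B₃ B₃' a₀ a₁)) ∧
        BetaUpperH β' γ₀ (betaOfRecord₁₃ F 2 (theta13OfThm1CCM F 2 3 ε₀ ε₂₉ B₃ B₃' a₀ a₁))) :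
    ∀ F : T4Family, ∃ θ : Stage13HParams F 2, θ.Provisos₁₃SepCoPH F 2 ∧ (θ.ZhUnity F 2 ∧ θ.SlotsNondegenerate₁₃ F 2) ∧ θ.Admissible F 2 :=
  record13SepCoPHBody_of_stubs123A (fun F => by
    obtain ⟨B₃, a₀, a₁, ha₀, ha₁, h8⟩ := h1 F
    exact prop8StepCoP_of_pos F ha₀ ha₁ h8) h2 h3A

/-- **★ K0⁷'s BODY AT EVERY FAMILY FROM SECT. F's ONE-PASS SENTENCE, STUB 2, STUB 3ᴬ**: Cʷ″ `record13SepCoPHBody_of_stubs123A` with its first binder replaced by the ONE-PASS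
text `∀ F, ∃ B₃ a₀ a₁, 0 < B₃ ∧ 0 < a₀ ∧ 0 < a₁ ∧ HalvingStepTop F 2 suppDomOfRecord B₃ a₀ a₁` ([15] Sect. F (144)–(168) at NODE 00's objects; dag-n07-e module 30 supplies print's
iteration, §1 the floor); `h2`, `h3A` are V18's stubs 2, 3ᴬ VERBATIM.  This is the shape a `k0-s1` seat can aim at directly.  CONDITIONAL; K0⁷ NOT closed here; nothing of Bałaban asserted.
[cite: Balaban1985Variational, Sect. F pp.300–304, Prop. 8 p.304, Thm 1 (8)–(9) p.279; Balaban1985RegularSpaces, Prop. 6 p.99; Balaban1988Convergent, Thm 1 p.262, (2.6)–(2.8) pp.255–256; Balaban1987RG1, Thm 1 p.259, §1 p.264] -/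
theorem record13SepCoPHBody_of_halvingStepTop23A
    (h1 : ∀ F : T4Family, ∃ B₃ a₀ a₁ : ℝ, 0 < B₃ ∧ 0 < a₀ ∧ 0 < a₁ ∧
      HalvingStepTop F 2 (fun ν K Ω => suppDomOfRecord F ν K Ω) B₃ a₀ a₁)
    (h2 : ∀ F : T4Family, ∃ B₁ c₁ : ℝ, 0 ≤ B₁ ∧ 0 < c₁ ∧
      (letI : CStarAlgebra (MatA 2) := {}; B8.Prop6Printed 4 (F.L : ℝ) B₁ c₁ (fun i : B8LeafModelZd.ZdIdx 4 F.L => zdCub (MatA 2) F.L i)))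
    (h3A : ∀ (F : T4Family) (B₃ B₃' a₀ a₁ : ℝ), 2 * (F.L : ℝ) ^ 2 ≤ B₃ → 0 < B₃' → 0 < a₀ → 0 < a₁ →
      VariationalThm1RegSepCoP7M F 2 B₃ a₀ a₁ →
      Gauge9RegSepTopStepR F 2 (fun ν K Ω => suppDomOfRecord F ν K Ω) (F.L ^ 3) ((11 * 4 + 3 * F.L) * F.L) B₃ B₃' a₀ a₁ →
      ∃ γ₀ ε₀ ε₂₉ β' : ℝ, 0 < γ₀ ∧ 0 < ε₀ ∧ 0 < ε₂₉ ∧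
        BetaLowerH (-β') γ₀ (betaOfRecord₁₃ F 2 (theta13OfThm1CCM F 2 3 ε₀ ε₂₉ B₃ B₃' a₀ a₁)) ∧
        BetaUpperH β' γ₀ (betaOfRecord₁₃ F 2 (theta13OfThm1CCM F 2 3 ε₀ ε₂₉ B₃ B₃' a₀ a₁))) :
    ∀ F : T4Family, ∃ θ : Stage13HParams F 2, θ.Provisos₁₃SepCoPH F 2 ∧ (θ.ZhUnity F 2 ∧ θ.SlotsNondegenerate₁₃ F 2) ∧ θ.Admissible F 2 :=
  record13SepCoPHBody_of_stubs123A (fun F => by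
    obtain ⟨B₃, a₀, a₁, hB₃, ha₀, ha₁, h⟩ := h1 F
    exact prop8StepCoP_of_halvingStepTop F hB₃ ha₀ ha₁ h) h2 h3A

end Composition

end Summit.QuantumFields.YangMills.Theorems.K0HalvingStepSocket

end
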